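import Mathlib
import HarnessLib
import Summits.HubbardSuperconductivity.HubbardSuperconductivity.Theorems.ComplexGFFStiffnessF4l2ShrinkLocOfBlockB4

/-!
# Crux child `TwoKernelSkBound` (stmt-HubbardSuperconductivity-27414), line `banach_two_kernel` (skeleton v3):
# the registered plumbing stub `stub_f4l2ShrinkLoc_of_blockB4`, BY NAME

Route `route-HubbardSuperconductivity-ComplexGFFStiffness`.  The registered stub `stub_f4l2ShrinkLoc_of_blockB4` of the v3 skeleton
(`Cruxes/HypACumulant/Lines/banach_two_kernel.lean`): the kernel parallelogram B4 for every `d = 4` package with positive radius implies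
the local `N`-free second-difference slot `F4l2ShrinkLoc 4`.  It is the landed reduction `f4l2ShrinkLoc_of_blockB4`
(`ComplexGFFStiffnessF4l2ShrinkLocOfBlockB4`, p833830: four-corner assembly p833574, blocks B1 p833412/p833510, B2/B3 p833227, engines
p833074, uniform bounds p833279/p832948, `opS`/`P.shrink` plumbing) re-exported under the registered name and signature.  All proved,
no `sorry`.  Honest scope: rung route (stiffness of a complex Gaussian gradient field via the [ABKM19] RG); nothing about
superconductivity in the Hubbard model; the crux child still hinges on `stub_blockB4`.

## References
* S. Adams, S. Buchholz, R. Kotecký, S. Müller, arXiv:1910.13564, Lemma 12.6 (12.53), Theorem 6.8 [AdamsBuchholzKoteckyMuller2019].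
-/

noncomputable section

-- `Summit.<Summit>.<Problem>`: single-conjunct summit, the duplicate component is mandated (D-0017).
set_option linter.dupNamespace false

namespace Summit.HubbardSuperconductivity.HubbardSuperconductivity.Theorems.ComplexGFF

open Literature.MathematicalPhysics.StatisticalMechanics.GradientRG
open Literature.MathematicalPhysics.StatisticalMechanics.TorusPolymer (reblock)
open Literature.MathematicalPhysics.StatisticalMechanics

/-- **Stub 2″ of skeleton v3 — `stub_f4l2ShrinkLoc_of_blockB4`** (registered on stmt-HubbardSuperconductivity-27414): B4 for every
`d = 4` package with `0 < P.r` implies `F4l2ShrinkLoc 4`. [cite: AdamsBuchholzKoteckyMuller2019, Lemma 12.6 (12.53) / Theorem 6.8] -/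
theorem stub_f4l2ShrinkLoc_of_blockB4 :
    (∀ (P : PackageData 4) [Fact (0 < P.h)] [Fact (0 < P.L)], 0 < P.r →
      ∃ l₄ T₂ : ℝ, 0 ≤ l₄ ∧ 0 < T₂ ∧ ∀ (N M : ℕ) [NeZero M] (Q : PackageAt P N M),
      ∀ q y z : Matrix (Fin 4) (Fin 4) ℝ, P.InBall q → P.InBall (q + y) → P.InBall (q + z) → P.InBall (q + y + z) →
      esum y ≤ T₂ → esum z ≤ T₂ → ∀ k, k + 1 ≤ N →
      ∀ (u : HamSpace ℂ 4 (fieldWt P.h (P.L : ℝ) 4 k) ((P.L : ℝ) ^ k) (P.L ^ (4 * k)))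
        (v : activitySpace Q.normParams k) (cv : ℝ), ‖u‖ ≤ P.r →
        activityNormLE Q.normParams k v cv → cv ≤ P.r →
      WeakNormLE Q.normParams (k + 1)
        (fun X ψ =>
          nextK (abkmStepData P.L P.R k (Q.kernels (q + y + z))).s
              (reblock (abkmStepData P.L P.R k (Q.kernels (q + y + z))).s
                ((abkmStepData P.L P.R k (Q.kernels (q + y + z))).L * (abkmStepData P.L P.R k (Q.kernels (q + y + z))).s))
              (stepMeasure (abkmStepData P.L P.R k (Q.kernels (q + y + z))).𝒞) (expNegH (HamSpace.toHam u))
              (expNegH (nextH (abkmStepData P.L P.R k (Q.kernels q)) (HamSpace.toHam u)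
                (mulExt ((v : activitySpace Q.normParams k) : Finset (Fin 4 → ZMod M) → ((Fin 4 → ZMod M) → ℝ) → ℂ))))
              (mulExt ((v : activitySpace Q.normParams k) : Finset (Fin 4 → ZMod M) → ((Fin 4 → ZMod M) → ℝ) → ℂ)) X ψ -
          nextK (abkmStepData P.L P.R k (Q.kernels (q + y))).s
              (reblock (abkmStepData P.L P.R k (Q.kernels (q + y))).s
                ((abkmStepData P.L P.R k (Q.kernels (q + y))).L * (abkmStepData P.L P.R k (Q.kernels (q + y))).s))
              (stepMeasure (abkmStepData P.L P.R k (Q.kernels (q + y))).𝒞) (expNegH (HamSpace.toHam u))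
              (expNegH (nextH (abkmStepData P.L P.R k (Q.kernels q)) (HamSpace.toHam u)
                (mulExt ((v : activitySpace Q.normParams k) : Finset (Fin 4 → ZMod M) → ((Fin 4 → ZMod M) → ℝ) → ℂ))))
              (mulExt ((v : activitySpace Q.normParams k) : Finset (Fin 4 → ZMod M) → ((Fin 4 → ZMod M) → ℝ) → ℂ)) X ψ -
          nextK (abkmStepData P.L P.R k (Q.kernels (q + z))).s
              (reblock (abkmStepData P.L P.R k (Q.kernels (q + z))).s
                ((abkmStepData P.L P.R k (Q.kernels (q + z))).L * (abkmStepData P.L P.R k (Q.kernels (q + z))).s))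
              (stepMeasure (abkmStepData P.L P.R k (Q.kernels (q + z))).𝒞) (expNegH (HamSpace.toHam u))
              (expNegH (nextH (abkmStepData P.L P.R k (Q.kernels q)) (HamSpace.toHam u)
                (mulExt ((v : activitySpace Q.normParams k) : Finset (Fin 4 → ZMod M) → ((Fin 4 → ZMod M) → ℝ) → ℂ))))
              (mulExt ((v : activitySpace Q.normParams k) : Finset (Fin 4 → ZMod M) → ((Fin 4 → ZMod M) → ℝ) → ℂ)) X ψ +
          nextK (abkmStepData P.L P.R k (Q.kernels q)).s
              (reblock (abkmStepData P.L P.R k (Q.kernels q)).s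
                ((abkmStepData P.L P.R k (Q.kernels q)).L * (abkmStepData P.L P.R k (Q.kernels q)).s))
              (stepMeasure (abkmStepData P.L P.R k (Q.kernels q)).𝒞) (expNegH (HamSpace.toHam u))
              (expNegH (nextH (abkmStepData P.L P.R k (Q.kernels q)) (HamSpace.toHam u)
                (mulExt ((v : activitySpace Q.normParams k) : Finset (Fin 4 → ZMod M) → ((Fin 4 → ZMod M) → ℝ) → ℂ))))
              (mulExt ((v : activitySpace Q.normParams k) : Finset (Fin 4 → ZMod M) → ((Fin 4 → ZMod M) → ℝ) → ℂ)) X ψ)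
        (l₄ * esum y * esum z * max ‖u‖ cv)) → F4l2ShrinkLoc 4 :=
  fun h => f4l2ShrinkLoc_of_blockB4 h

end Summit.HubbardSuperconductivity.HubbardSuperconductivity.Theorems.ComplexGFF

end
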